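import Summits.BirchSwinnertonDyer.BirchSwinnertonDyer.Theorems.SelmerRankSelmerRankLBOfHeegnerGap
import HarnessLib

/-!
# BirchSwinnertonDyer / SelmerRank — crux `SelmerRankLB` (stmt-BirchSwinnertonDyer-0131):
# the RANK-TWO BRIDGE to the item `SelmerRankRankTwo` (stmt-BirchSwinnertonDyer-0129)

Line `heegner_order` of the crux `SelmerRankLB` (`r_an(E) ≤ corank_{ℤ_p} Sel_{p^∞}(E/ℚ)` at primes
`p ≥ 5` of good ordinary reduction with `ρ̄_{E,p}` surjective; lead seat
`prover-line-stmt-BirchSwinnertonDyer-0131-c2`, 2026-08-17). The line's open core HV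
(`stub_heegner_gap`) is kernel-checked equivalent to the crux from `r_an = 4` on modulo nine named
literature facts (`SelmerRankSelmerRankLBOfHeegnerGap.lean`: `selmerRankLB_of_heegnerGap_of_facts`,
`heegnerGap_of_selmerRankLB_of_facts`), and the range `r_an ≤ 3` closes with no open input
(`selmerRankLB_of_facts_of_analyticRank_le_three_heegner`). This file pins the NEXT RUNG of the
crux — and of HV — to an EXISTING ledger item instead of to prose: the rank-two case
`SelmerRank.SelmerRankRankTwo` (stmt-BirchSwinnertonDyer-0129: at the same primes,
`corank_p Sel_{p^∞}(E/ℚ) = 2 ↔ ord_{s=1} L(E, s) = 2`).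

* `rankTwo_mp_of_selmerRankLB_of_gzk`: the crux implies the forward half of RankTwo
  (`corank_p = 2 ⇒ r_an = 2`) modulo Gross–Zagier–Kolyvagin alone (`r_an ≤ 1 ⇒ corank_p = r_an`,
  tree theorem `selmerCorank_eq_analyticRank_of_analyticRank_le_one` behind the named fact
  `rank_eq_analyticRank_of_analyticRank_le_one`). So the ITEM stmt-0131 cannot close before
  RankTwo.mp lands: the crux is blocked on stmt-0129 in that strict sense. (Rung by rung the picture
  is finer: modulo the nine facts the slice `r_an = 4` of the crux is `corank_p = 2 ⇒ r_an ≠ 4`,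
  while RankTwo.mp is `corank_p = 2 ⇒ r_an ∉ {4, 6, 8, …}` — the slices `r_an ∈ {0, 1, 3, 5, …}`
  of it being free by GZK and Kolyvagin's parity clause — i.e. RankTwo.mp = the crux on the curves
  with `corank_p = 2`.)
* (Conversely the two halves LB (stmt-0131) and UB (stmt-0130) give the item RankTwo outright by
  `omega`; not stated here to keep this file free of any `proof-of-item` shape for stmt-0129.)
* `selmerRankLB_of_pConverses_of_facts_heegner` (the LADDER): modulo the nine heegner facts, the
  `p`-converse inequalities `2 ≤ corank_p ≤ C ⇒ r_an ≤ corank_p` give the crux for every curve with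
  `r_an ≤ C + 2`. Mechanism (Kolyvagin): if `c := corank_p < r := r_an`, the Heegner Kolyvagin system
  over the auxiliary field of HK has a non-zero class at depth `ν = c − 1 ≥ 1` with `c ≡ r (mod 2)`
  (HZ + HT + HG), so `2 ≤ c ≤ r − 2 ≤ C` and the `p`-converse at `c` gives `r ≤ c` — absurd. No
  `p`-parity theorem and no corank-0/1 converse is used (Kolyvagin's parity clause and Gross–Zagier
  replace them), which is why the ladder starts at `c = 2`.
* `pConverses_of_selmerRankLB`: conversely the crux gives every rung (trivial) — the ladder is the
  crux, rung by rung; its first rung is RankTwo.mp.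
* `selmerRankLB_of_rankTwo_of_facts_of_analyticRank_le_four`: RankTwo + the nine facts ⇒ the crux
  for `r_an ≤ 4` (the ladder at `C = 2`), one rank beyond the known range.
* `heegnerGap_at_of_analyticRank_le_selmerCorank`: POINTWISE form of
  `heegnerGap_of_selmerRankLB_of_facts` — the crux AT `(W, p)` plus Kolyvagin 1991 Thm. 4 gives HV at
  `(W, p)`; hence `heegnerGap_of_rankTwo_of_facts_of_analyticRank_le_four`: RankTwo + the nine facts
  ⇒ HV for every curve with `r_an ≤ 4`, i.e. the stub's first instance `(r_an, ν) = (4, 1)` IS the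
  item stmt-0129 (forward half) modulo theorems in print.

Everything here is CONDITIONAL on named `def … : Prop` facts (listed in each signature) and credits
nothing to either item; it records the dependency edge stmt-0131 ⇄ stmt-0129 for the planners.

References: V. A. Kolyvagin, *On the structure of Selmer groups*, Math. Ann. 291 (1991) 253–259,
Thm. 4; W. Zhang, *Selmer groups and the indivisibility of Heegner points*, Camb. J. Math. 2 (2014),
Thm. 1.2; A. Burungale, F. Castella, G. Grossi, C. Skinner, *Non-vanishing of Kolyvagin systems and
Iwasawa theory*, arXiv:2312.09301, Thm. 1 and Cor. 1; B. Gross, D. Zagier, Invent. Math. 84 (1986),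
Thm. I.6.3; V. A. Kolyvagin, *Euler systems* (1990), Thm. A; D. Jetchev, K. Lauter, W. Stein,
*Explicit Heegner points: Kolyvagin's conjecture and non-trivial elements in the Shafarevich–Tate
group*, J. Number Theory 129 (2009), Cor. 3.5.
-/

set_option linter.dupNamespace false

noncomputable section

namespace Summit.BirchSwinnertonDyer.BirchSwinnertonDyer.Theorems

open scoped Classical
open Literature.NumberTheory.EllipticCurves Literature.NumberTheory.EllipticCurves.ModularForms
  WeierstrassCurve
open Summit.BirchSwinnertonDyer.BirchSwinnertonDyer.Theses

/-! ### The crux implies the forward half of RankTwo -/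

/-- **The crux forces the forward half of the rank-two case.** Modulo Gross–Zagier–Kolyvagin
(`rank_eq_analyticRank_of_analyticRank_le_one`: `r_an ≤ 1 ⇒ rank = r_an ∧ Ш finite`, whence
`corank_p = r_an` by Greenberg's proved identity, `selmerCorank_eq_analyticRank_of_analyticRank_le_one`),
`SelmerRankLB` gives, at every prime of the crux, `corank_p Sel_{p^∞}(E/ℚ) = 2 ⇒ ord_{s=1} L(E,s) = 2`:
the crux bounds `r_an ≤ 2`, and `r_an ≤ 1` would force `corank_p = r_an ≤ 1 ≠ 2`. Hence any proof
of the (full) crux proves the (→) half of item stmt-BirchSwinnertonDyer-0129; only the instances of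
the crux at the curves with `corank_p = 2` are used. CONDITIONAL on the named fact; credits nothing. [cite: GrossZagier1986, Thm. I.6.3] [cite: Kolyvagin1990, Thm. A] -/
theorem rankTwo_mp_of_selmerRankLB_of_gzk :
    rank_eq_analyticRank_of_analyticRank_le_one → SelmerRank.SelmerRankLB →
    ∀ (W : WeierstrassCurve ℚ) [W.IsElliptic] [W.IsGloballyMinimal] (p : ℕ) [Fact p.Prime],
      5 ≤ p → W.HasGoodReductionAtPrime p → ¬ (p : ℤ) ∣ W.frobeniusTrace p →
      W.HasSurjectiveModNGaloisRep p → W.selmerCorank p = 2 → W.analyticRank = 2 := by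
  intro hGZK hLB W _ _ p _ h5 hgood hord hsurj hc
  have hle : W.analyticRank ≤ W.selmerCorank p := hLB W p h5 hgood hord hsurj
  by_contra hne
  have h1 : W.analyticRank ≤ 1 := by omega
  have heq := selmerCorank_eq_analyticRank_of_analyticRank_le_one hGZK W p h1
  omega

/-! ### The ladder: `p`-converses for `2 ≤ c ≤ C` give the crux for `r_an ≤ C + 2` -/

/-- **The `p`-converse ladder along the Heegner line.** Modulo the nine named facts of
`SelmerRankSelmerRankLBOfHeegnerGap.lean` {modularity `exists_isNewformOf`; Hoffstein–Luo and
Bump–Friedberg–Hoffstein twist supplies; Gross–Zagier–Kolyvagin; `analyticRankEK_eq_add`; the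
Gross–Zagier non-torsion criterion; conductor-`1` Shimura reciprocity; BCGS 2026 Thm. 1; Kolyvagin
1991 Thm. 4}: if at the crux's primes every curve with `2 ≤ corank_p ≤ C` satisfies
`r_an ≤ corank_p` (the `p`-converse inequalities up to corank `C`), then every curve with
`r_an ≤ C + 2` satisfies the crux `r_an ≤ corank_p`. Proof (Kolyvagin's mechanism, as in
`selmerRankLB_of_facts_of_analyticRank_le_three_heegner`): if `c := corank_p < r := r_an`, take the
auxiliary field `K` of HK (`r' = r_an(E^{(d_K)}) ≤ 1`, `r + r'` odd), so `c' = r'` (HT); BCGS +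
Kolyvagin's structure theorem (HZ) give a non-zero class at depth `ν = max(c, c') − 1` with
`ν + min(c, c')` even; `ν = 0` contradicts Gross–Zagier (HG, `r + r' ≥ 2`); `ν ≥ 1` forces
`c = ν + 1 ≥ 2` and `c ≡ r' + 1 ≡ r (mod 2)`, so `2 ≤ c ≤ r − 2 ≤ C` and the rung at `c` gives
`r ≤ c` — absurd. Neither the `p`-parity theorem nor a corank-0/1 `p`-converse is used. CONDITIONAL
on the nine named facts; credits nothing. [cite: Kolyvagin1991MathAnn, §2 Thm. 4]
[cite: BurungaleEtAl2026, Thm. 1 (arXiv:2312.09301 §0.1)] [cite: JetchevLauterStein2009, Cor. 3.5] -/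
theorem selmerRankLB_of_pConverses_of_facts_heegner :
    exists_isNewformOf → HoffsteinLuo1997_exists_twist_L_one_ne_zero →
    bumpFriedbergHoffstein_exists_heegnerField_split_twist_simpleZero →
    rank_eq_analyticRank_of_analyticRank_le_one →
    (∀ (W : WeierstrassCurve ℚ) (K : Type) [Field K] [NumberField K], analyticRankEK_eq_add W K) →
    (∀ (W : WeierstrassCurve ℚ) (N : ℕ) [NeZero N] (K : Type) [Field K] [NumberField K],
        analyticRankEK_eq_one_iff_heegner_nonTorsion W N K) →
    (∀ (N : ℕ) [NeZero N] (W : WeierstrassCurve ℚ) (K : Type) [Field K] [NumberField K],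
        heegnerPointOfConductor_one_galoisConj N W K) →
    BurungaleEtAl2026_exists_kolyvaginClass_ne_zero →
    Kolyvagin1991_selmerCorank_of_kolyvaginClass_ne_zero →
    ∀ C : ℕ,
      (∀ (W : WeierstrassCurve ℚ) [W.IsElliptic] [W.IsGloballyMinimal] (p : ℕ) [Fact p.Prime],
        5 ≤ p → W.HasGoodReductionAtPrime p → ¬ (p : ℤ) ∣ W.frobeniusTrace p →
        W.HasSurjectiveModNGaloisRep p → 2 ≤ W.selmerCorank p → W.selmerCorank p ≤ C →
        W.analyticRank ≤ W.selmerCorank p) →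
      ∀ (W : WeierstrassCurve ℚ) [W.IsElliptic] [W.IsGloballyMinimal] (p : ℕ) [Fact p.Prime],
        5 ≤ p → W.HasGoodReductionAtPrime p → ¬ (p : ℤ) ∣ W.frobeniusTrace p →
        W.HasSurjectiveModNGaloisRep p → W.analyticRank ≤ C + 2 →
        W.analyticRank ≤ W.selmerCorank p := by
  intro hmod hHL hBFH hGZK hadd hGZ hrec hA hB C hconv W _ _ p hp h5 hgood hord hsurj hrC
  by_contra hlt
  push Not at hlt
  haveI : NeZero (W.conductorNorm ℤ) := ⟨(W.conductorNorm_pos_holds).ne'⟩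
  obtain ⟨K, iF, iN, hK, h3, h4, hpd, hH, hdo, hps, hr'le, hodd⟩ :=
    stub_heegner_field_supply_of_facts hmod hHL hBFH W p h5 hgood hord hsurj
  have hc' : (W.quadraticTwist (NumberField.discr K : ℚ)).selmerCorank p =
      (W.quadraticTwist (NumberField.discr K : ℚ)).analyticRank :=
    stub_twist_corank_eq_of_facts hGZK W p h5 hgood hord hsurj K hK h3 h4 hpd hH hr'le
  obtain ⟨Dt, β, ι, n, d, M, hsq, _, _, _, hne, hmax, hpar⟩ :=
    stub_kolyvagin_structure_of_facts hA hB W p h5 hgood hord hsurj K hK h3 h4 hpd hH hdo hps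
  have hk : (W.analyticRank + (W.quadraticTwist (NumberField.discr K : ℚ)).analyticRank) % 2 = 1 :=
    Nat.odd_iff.mp hodd
  have hj : (n.primeFactors.card + min (W.selmerCorank p)
      ((W.quadraticTwist (NumberField.discr K : ℚ)).selmerCorank p)) % 2 = 0 :=
    Nat.even_iff.mp hpar
  rcases Nat.eq_zero_or_pos n.primeFactors.card with hν0 | hν1
  · -- depth 0: `n = 1`, and the bottom class must vanish by Gross–Zagier
    have hn1 : n = 1 := heegnerGap_eq_one_of_card_primeFactors_eq_zero hsq hν0
    subst hn1
    have h2 : 2 ≤ W.analyticRank + (W.quadraticTwist (NumberField.discr K : ℚ)).analyticRank := by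
      rcases le_total (W.selmerCorank p) ((W.quadraticTwist (NumberField.discr K : ℚ)).selmerCorank p)
        with hcc | hcc
      · rw [max_eq_right hcc] at hmax; omega
      · rw [max_eq_left hcc] at hmax; omega
    exact hne (stub_heegner_bottom_torsion_of_facts hadd hGZ hrec W p h5 hgood hord hsurj K hK h3 h4
      hpd hH h2 Dt β ι d M)
  · rcases le_total (W.selmerCorank p) ((W.quadraticTwist (NumberField.discr K : ℚ)).selmerCorank p)
      with hcc | hcc
    · -- `max = c' = r' ≤ 1` forces `ν = 0`: impossible
      rw [max_eq_right hcc] at hmax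
      omega
    · rw [max_eq_left hcc] at hmax
      rw [min_eq_right hcc] at hj
      -- `c = ν + 1 ≥ 2`, `c ≡ r (mod 2)`, `c < r ≤ C + 2`: the rung at `c ≤ C` applies
      have h2c : 2 ≤ W.selmerCorank p := by omega
      have hcC : W.selmerCorank p ≤ C := by omega
      have := hconv W p h5 hgood hord hsurj h2c hcC
      omega

/-- **Conversely, the crux gives every rung of the ladder** (trivial: `r_an ≤ corank_p` is the
rung's conclusion). Together with `selmerRankLB_of_pConverses_of_facts_heegner`: modulo the nine
named facts, the crux IS the ladder of `p`-converse inequalities `2 ≤ corank_p = c ⇒ r_an ≤ c`,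
`c = 2, 3, 4, …`, whose first rung is the forward half of `SelmerRankRankTwo` (stmt-0129).
[folklore] -/
theorem pConverses_of_selmerRankLB :
    SelmerRank.SelmerRankLB → ∀ C : ℕ,
      ∀ (W : WeierstrassCurve ℚ) [W.IsElliptic] [W.IsGloballyMinimal] (p : ℕ) [Fact p.Prime],
        5 ≤ p → W.HasGoodReductionAtPrime p → ¬ (p : ℤ) ∣ W.frobeniusTrace p →
        W.HasSurjectiveModNGaloisRep p → 2 ≤ W.selmerCorank p → W.selmerCorank p ≤ C →
        W.analyticRank ≤ W.selmerCorank p := by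
  intro hLB C W _ _ p _ h5 hgood hord hsurj _ _
  exact hLB W p h5 hgood hord hsurj

/-! ### The first rung: RankTwo gives the crux and HV for `r_an ≤ 4` -/

/-- **RankTwo ⇒ the crux one rank beyond the known range.** Modulo the nine named facts of the
Heegner line, the item `SelmerRankRankTwo` (stmt-BirchSwinnertonDyer-0129; only its forward half
`corank_p = 2 ⇒ r_an = 2` is used) gives `r_an ≤ corank_p Sel_{p^∞}` for every curve in the crux's
range with `ord_{s=1} L(E, s) ≤ 4`: the ladder `selmerRankLB_of_pConverses_of_facts_heegner` at
`C = 2`. (At `r_an = 4`: `c < 4`, `c ≡ 0 (mod 2)`, `c ≥ 2` ⇒ `c = 2` ⇒ `r_an = 2`, absurd.)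
CONDITIONAL on the nine named facts; credits nothing to either item.
[cite: Kolyvagin1991MathAnn, §2 Thm. 4] [cite: BurungaleEtAl2026, Thm. 1 (arXiv:2312.09301 §0.1)] -/
theorem selmerRankLB_of_rankTwo_of_facts_of_analyticRank_le_four :
    exists_isNewformOf → HoffsteinLuo1997_exists_twist_L_one_ne_zero →
    bumpFriedbergHoffstein_exists_heegnerField_split_twist_simpleZero →
    rank_eq_analyticRank_of_analyticRank_le_one →
    (∀ (W : WeierstrassCurve ℚ) (K : Type) [Field K] [NumberField K], analyticRankEK_eq_add W K) →
    (∀ (W : WeierstrassCurve ℚ) (N : ℕ) [NeZero N] (K : Type) [Field K] [NumberField K],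
        analyticRankEK_eq_one_iff_heegner_nonTorsion W N K) →
    (∀ (N : ℕ) [NeZero N] (W : WeierstrassCurve ℚ) (K : Type) [Field K] [NumberField K],
        heegnerPointOfConductor_one_galoisConj N W K) →
    BurungaleEtAl2026_exists_kolyvaginClass_ne_zero →
    Kolyvagin1991_selmerCorank_of_kolyvaginClass_ne_zero →
    SelmerRank.SelmerRankRankTwo →
    ∀ (W : WeierstrassCurve ℚ) [W.IsElliptic] [W.IsGloballyMinimal] (p : ℕ) [Fact p.Prime],
      5 ≤ p → W.HasGoodReductionAtPrime p → ¬ (p : ℤ) ∣ W.frobeniusTrace p →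
      W.HasSurjectiveModNGaloisRep p → W.analyticRank ≤ 4 → W.analyticRank ≤ W.selmerCorank p := by
  intro hmod hHL hBFH hGZK hadd hGZ hrec hA hB hRT W _ _ p hp h5 hgood hord hsurj hr4
  refine selmerRankLB_of_pConverses_of_facts_heegner hmod hHL hBFH hGZK hadd hGZ hrec hA hB 2 ?_
    W p h5 hgood hord hsurj hr4
  intro W' _ _ p' _ h5' hgood' hord' hsurj' h2 hC
  have hc2 : W'.selmerCorank p' = 2 := le_antisymm hC h2
  have hr2 : W'.analyticRank = 2 := (hRT W' p' h5' hgood' hord' hsurj').mp hc2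
  omega

/-- **The crux AT ONE `(W, p)` already gives HV at `(W, p)`** — pointwise form of
`heegnerGap_of_selmerRankLB_of_facts`, modulo Kolyvagin's structure theorem alone. For `K`
imaginary quadratic with `d_K ∉ {−3, −4}`, `p ∤ d_K` and the Heegner hypothesis, a non-zero class
`c_M(n) ≠ 0` (`n` a square-free product of Kolyvagin primes, `1 ≤ M ≤ M(n)`) at depth
`ν(n) ≤ r_an − 3` is impossible once `r_an ≤ corank_p` holds for THIS curve and prime: minimise the
depth over the non-zero classes of the system `(Dt, β, ι)` (`Nat.find`), `ν₀ ≤ ν(n)`; Kolyvagin 1991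
Thm. 4 (`Kolyvagin1991_selmerCorank_of_kolyvaginClass_ne_zero`, `p ∤ N_E` from good reduction)
gives `c = ν₀ + 1` or `c ≤ ν₀`, so `c ≤ ν(n) + 1 ≤ r_an − 2 < r_an ≤ c`. The hypotheses `Odd d_K`,
`p` split, `r' ≤ 1`, parity and `1 ≤ ν(n)` of HV are idle. CONDITIONAL on the named fact; credits
nothing. [cite: Kolyvagin1991MathAnn, §2 Thm. 4] [cite: WZhang2014, Thm. 11.2 (i) (p. 248)] -/
theorem heegnerGap_at_of_analyticRank_le_selmerCorank :
    Kolyvagin1991_selmerCorank_of_kolyvaginClass_ne_zero →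
    ∀ (W : WeierstrassCurve ℚ) [W.IsElliptic] [W.IsGloballyMinimal] (p : ℕ) [hp : Fact p.Prime],
      5 ≤ p → W.HasGoodReductionAtPrime p → ¬ (p : ℤ) ∣ W.frobeniusTrace p →
      W.HasSurjectiveModNGaloisRep p → W.analyticRank ≤ W.selmerCorank p →
      ∀ (K : Type) [Field K] [NumberField K], IsImaginaryQuadratic K →
        NumberField.discr K ≠ -3 → NumberField.discr K ≠ -4 → ¬ ((p : ℤ) ∣ NumberField.discr K) →
        ∀ [NeZero (W.conductorNorm ℤ)], SatisfiesHeegnerHypothesis (W.conductorNorm ℤ) K →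
        Odd (NumberField.discr K) → SatisfiesHeegnerHypothesis p K →
        (W.quadraticTwist (NumberField.discr K : ℚ)).analyticRank ≤ 1 →
        Odd (W.analyticRank + (W.quadraticTwist (NumberField.discr K : ℚ)).analyticRank) →
        ∀ (Dt : ModularParametrizationData W (W.conductorNorm ℤ)) (β : ℤ) (ι : K →+* ℂ) (n : ℕ)
          (d : KolyvaginHeegnerData Dt β ι n) (M : ℕ),
          Squarefree n → (∀ ℓ ∈ n.primeFactors, Zhang2014.IsKolyvaginPrime (W.conductorNorm ℤ) W K p ℓ) →
          1 ≤ M → (M : ℕ∞) ≤ Zhang2014.levelIndex W p n →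
          1 ≤ n.primeFactors.card → n.primeFactors.card + 3 ≤ W.analyticRank →
          Even (n.primeFactors.card + W.analyticRank + 1) →
          d.kolyvaginClass hp.out M = 0 := by
  intro hB W _ _ p hp h5 hgood _ hsurj hcrux K _ _ hK h3 h4 hpd _ hH _ _ _ _ Dt β ι n d M hsq hkoly
    hM1 hMle _ hν3 _
  by_contra hne
  have hpN : ¬ (p ∣ W.conductorNorm ℤ) := fun h ↦
    (W.dvd_conductorNorm_iff_not_hasGoodReductionAtPrime p).mp h hgood
  -- minimise the depth over the non-zero classes of the system `(Dt, β, ι)`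
  have hex : ∃ k, ∃ (n' : ℕ) (d' : KolyvaginHeegnerData Dt β ι n') (M' : ℕ),
      KolyvaginDescent.KolSupp (Zhang2014.IsKolyvaginPrime (W.conductorNorm ℤ) W K p) n' ∧
        1 ≤ M' ∧ (M' : ℕ∞) ≤ Zhang2014.levelIndex W p n' ∧ d'.kolyvaginClass hp.out M' ≠ 0 ∧
        n'.primeFactors.card = k :=
    ⟨_, n, d, M, ⟨hsq, hkoly⟩, hM1, hMle, hne, rfl⟩
  obtain ⟨n₀, d₀, M₀, hΛ₀, hM₀, hM₀le, hne₀, hcard₀⟩ := Nat.find_spec hex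
  have hmin : ∀ (n' : ℕ) (d' : KolyvaginHeegnerData Dt β ι n') (M' : ℕ),
      KolyvaginDescent.KolSupp (Zhang2014.IsKolyvaginPrime (W.conductorNorm ℤ) W K p) n' →
      1 ≤ M' → (M' : ℕ∞) ≤ Zhang2014.levelIndex W p n' → d'.kolyvaginClass hp.out M' ≠ 0 →
      n₀.primeFactors.card ≤ n'.primeFactors.card := by
    intro n' d' M' hΛ' hM' hM'le hne'
    rw [hcard₀]
    exact Nat.find_min' hex ⟨n', d', M', hΛ', hM', hM'le, hne', rfl⟩
  have hle : n₀.primeFactors.card ≤ n.primeFactors.card :=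
    hmin n d M ⟨hsq, hkoly⟩ hM1 hMle hne
  -- Kolyvagin's structure theorem at the minimiser
  have hstruct := hB W p h5 hsurj K hK h3 h4 hpd hpN hH Dt β ι n₀ d₀ M₀ hΛ₀ hM₀ hM₀le hne₀ hmin
  rcases hstruct with ⟨hc, -, -⟩ | ⟨-, hc, -⟩
  · omega
  · omega

/-- **RankTwo ⇒ HV for `r_an ≤ 4`: the stub's first instance `(r_an, ν) = (4, 1)` IS the forward
half of item stmt-BirchSwinnertonDyer-0129 modulo theorems in print.** Modulo the nine named facts
of the Heegner line: if `corank_p = 2 ↔ r_an = 2` at the crux's primes (`SelmerRankRankTwo`), then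
for every curve with `ord_{s=1} L(E, s) ≤ 4` the registered stub `stub_heegner_gap` holds — every
derived Heegner class `c_M(n)`, `n` a square-free product of `ν(n) ≥ 1` Kolyvagin primes with
`ν(n) + 3 ≤ r_an` (so `r_an = 4`, `ν(n) = 1`: the single derived point `P(ℓ)` at every Kolyvagin
prime `ℓ`) and `ν(n) ≡ r_an + 1 (mod 2)`, vanishes: `selmerRankLB_of_rankTwo_of_facts_of_analyticRank_le_four`
gives the crux at `(W, p)`, and `heegnerGap_at_of_analyticRank_le_selmerCorank` turns it into HV at
`(W, p)`. CONDITIONAL on the nine named facts; credits nothing.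
[cite: Kolyvagin1991MathAnn, §2 Thm. 4] [cite: BurungaleEtAl2026, Thm. 1 (arXiv:2312.09301 §0.1)] -/
theorem heegnerGap_of_rankTwo_of_facts_of_analyticRank_le_four :
    exists_isNewformOf → HoffsteinLuo1997_exists_twist_L_one_ne_zero →
    bumpFriedbergHoffstein_exists_heegnerField_split_twist_simpleZero →
    rank_eq_analyticRank_of_analyticRank_le_one →
    (∀ (W : WeierstrassCurve ℚ) (K : Type) [Field K] [NumberField K], analyticRankEK_eq_add W K) →
    (∀ (W : WeierstrassCurve ℚ) (N : ℕ) [NeZero N] (K : Type) [Field K] [NumberField K],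
        analyticRankEK_eq_one_iff_heegner_nonTorsion W N K) →
    (∀ (N : ℕ) [NeZero N] (W : WeierstrassCurve ℚ) (K : Type) [Field K] [NumberField K],
        heegnerPointOfConductor_one_galoisConj N W K) →
    BurungaleEtAl2026_exists_kolyvaginClass_ne_zero →
    Kolyvagin1991_selmerCorank_of_kolyvaginClass_ne_zero →
    SelmerRank.SelmerRankRankTwo →
    ∀ (W : WeierstrassCurve ℚ) [W.IsElliptic] [W.IsGloballyMinimal] (p : ℕ) [hp : Fact p.Prime],
      5 ≤ p → W.HasGoodReductionAtPrime p → ¬ (p : ℤ) ∣ W.frobeniusTrace p →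
      W.HasSurjectiveModNGaloisRep p → W.analyticRank ≤ 4 →
      ∀ (K : Type) [Field K] [NumberField K], IsImaginaryQuadratic K →
        NumberField.discr K ≠ -3 → NumberField.discr K ≠ -4 → ¬ ((p : ℤ) ∣ NumberField.discr K) →
        ∀ [NeZero (W.conductorNorm ℤ)], SatisfiesHeegnerHypothesis (W.conductorNorm ℤ) K →
        Odd (NumberField.discr K) → SatisfiesHeegnerHypothesis p K →
        (W.quadraticTwist (NumberField.discr K : ℚ)).analyticRank ≤ 1 →
        Odd (W.analyticRank + (W.quadraticTwist (NumberField.discr K : ℚ)).analyticRank) →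
        ∀ (Dt : ModularParametrizationData W (W.conductorNorm ℤ)) (β : ℤ) (ι : K →+* ℂ) (n : ℕ)
          (d : KolyvaginHeegnerData Dt β ι n) (M : ℕ),
          Squarefree n → (∀ ℓ ∈ n.primeFactors, Zhang2014.IsKolyvaginPrime (W.conductorNorm ℤ) W K p ℓ) →
          1 ≤ M → (M : ℕ∞) ≤ Zhang2014.levelIndex W p n →
          1 ≤ n.primeFactors.card → n.primeFactors.card + 3 ≤ W.analyticRank →
          Even (n.primeFactors.card + W.analyticRank + 1) →
          d.kolyvaginClass hp.out M = 0 := by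
  intro hmod hHL hBFH hGZK hadd hGZ hrec hA hB hRT W _ _ p hp h5 hgood hord hsurj hr4
  have hcrux : W.analyticRank ≤ W.selmerCorank p :=
    selmerRankLB_of_rankTwo_of_facts_of_analyticRank_le_four hmod hHL hBFH hGZK hadd hGZ hrec hA hB
      hRT W p h5 hgood hord hsurj hr4
  exact heegnerGap_at_of_analyticRank_le_selmerCorank hB W p h5 hgood hord hsurj hcrux

/-! ### The phantom profile: what a counterexample must look like along this line -/

/-- **Profile of a counterexample, modulo the nine facts.** At the crux's primes, if
`corank_p Sel_{p^∞}(E/ℚ) < ord_{s=1} L(E, s)` (a failure of the crux at `(W, p)`), then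
`2 ≤ corank_p ≤ r_an − 2` and `corank_p ≡ r_an (mod 2)`: by HK/HT/HZ/HG (as in the ladder) the
Heegner Kolyvagin system over the auxiliary field has a non-zero class at depth `ν = corank_p − 1 ≥ 1`
with Kolyvagin's parity clause `corank_p ≡ r' + 1 ≡ r_an (mod 2)`. This is the sharpest constraint the
closed part of the line puts on a phantom curve (cf. `CensusChecks.lean`, profile `(4, 2, …)`): the
first admissible phantom is `r_an = 4`, `corank_p = 2` — excluded exactly by RankTwo.mp — then
`(5, 3)`, `(6, 2)`, `(6, 4)`, …; the ladder `selmerRankLB_of_pConverses_of_facts_heegner` is its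
contrapositive read rung by rung. No `p`-parity theorem is used (the congruence comes from
Kolyvagin's structure theorem). CONDITIONAL on the nine named facts; credits nothing.
[cite: Kolyvagin1991MathAnn, §2 Thm. 4] [cite: BurungaleEtAl2026, Thm. 1 (arXiv:2312.09301 §0.1)] -/
theorem phantomProfile_of_selmerCorank_lt_analyticRank_of_facts_heegner :
    exists_isNewformOf → HoffsteinLuo1997_exists_twist_L_one_ne_zero →
    bumpFriedbergHoffstein_exists_heegnerField_split_twist_simpleZero →
    rank_eq_analyticRank_of_analyticRank_le_one →
    (∀ (W : WeierstrassCurve ℚ) (K : Type) [Field K] [NumberField K], analyticRankEK_eq_add W K) →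
    (∀ (W : WeierstrassCurve ℚ) (N : ℕ) [NeZero N] (K : Type) [Field K] [NumberField K],
        analyticRankEK_eq_one_iff_heegner_nonTorsion W N K) →
    (∀ (N : ℕ) [NeZero N] (W : WeierstrassCurve ℚ) (K : Type) [Field K] [NumberField K],
        heegnerPointOfConductor_one_galoisConj N W K) →
    BurungaleEtAl2026_exists_kolyvaginClass_ne_zero →
    Kolyvagin1991_selmerCorank_of_kolyvaginClass_ne_zero →
    ∀ (W : WeierstrassCurve ℚ) [W.IsElliptic] [W.IsGloballyMinimal] (p : ℕ) [Fact p.Prime],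
      5 ≤ p → W.HasGoodReductionAtPrime p → ¬ (p : ℤ) ∣ W.frobeniusTrace p →
      W.HasSurjectiveModNGaloisRep p → W.selmerCorank p < W.analyticRank →
      2 ≤ W.selmerCorank p ∧ W.selmerCorank p + 2 ≤ W.analyticRank ∧
        W.selmerCorank p % 2 = W.analyticRank % 2 := by
  intro hmod hHL hBFH hGZK hadd hGZ hrec hA hB W _ _ p hp h5 hgood hord hsurj hlt
  haveI : NeZero (W.conductorNorm ℤ) := ⟨(W.conductorNorm_pos_holds).ne'⟩
  obtain ⟨K, iF, iN, hK, h3, h4, hpd, hH, hdo, hps, hr'le, hodd⟩ :=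
    stub_heegner_field_supply_of_facts hmod hHL hBFH W p h5 hgood hord hsurj
  have hc' : (W.quadraticTwist (NumberField.discr K : ℚ)).selmerCorank p =
      (W.quadraticTwist (NumberField.discr K : ℚ)).analyticRank :=
    stub_twist_corank_eq_of_facts hGZK W p h5 hgood hord hsurj K hK h3 h4 hpd hH hr'le
  obtain ⟨Dt, β, ι, n, d, M, hsq, _, _, _, hne, hmax, hpar⟩ :=
    stub_kolyvagin_structure_of_facts hA hB W p h5 hgood hord hsurj K hK h3 h4 hpd hH hdo hps
  have hk : (W.analyticRank + (W.quadraticTwist (NumberField.discr K : ℚ)).analyticRank) % 2 = 1 :=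
    Nat.odd_iff.mp hodd
  have hj : (n.primeFactors.card + min (W.selmerCorank p)
      ((W.quadraticTwist (NumberField.discr K : ℚ)).selmerCorank p)) % 2 = 0 :=
    Nat.even_iff.mp hpar
  rcases Nat.eq_zero_or_pos n.primeFactors.card with hν0 | hν1
  · -- depth 0: `n = 1`, and the bottom class must vanish by Gross–Zagier
    have hn1 : n = 1 := heegnerGap_eq_one_of_card_primeFactors_eq_zero hsq hν0
    subst hn1
    have h2 : 2 ≤ W.analyticRank + (W.quadraticTwist (NumberField.discr K : ℚ)).analyticRank := by
      rcases le_total (W.selmerCorank p) ((W.quadraticTwist (NumberField.discr K : ℚ)).selmerCorank p)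
        with hcc | hcc
      · rw [max_eq_right hcc] at hmax; omega
      · rw [max_eq_left hcc] at hmax; omega
    exact absurd (stub_heegner_bottom_torsion_of_facts hadd hGZ hrec W p h5 hgood hord hsurj K hK h3
      h4 hpd hH h2 Dt β ι d M) hne
  · rcases le_total (W.selmerCorank p) ((W.quadraticTwist (NumberField.discr K : ℚ)).selmerCorank p)
      with hcc | hcc
    · -- `max = c' = r' ≤ 1` forces `ν = 0`: impossible
      rw [max_eq_right hcc] at hmax
      omega
    · rw [max_eq_left hcc] at hmax
      rw [min_eq_right hcc] at hj
      refine ⟨by omega, by omega, by omega⟩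

end Summit.BirchSwinnertonDyer.BirchSwinnertonDyer.Theorems

end
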